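import Mathlib
import HarnessLib
import Summits.HubbardSuperconductivity.HubbardSuperconductivity.Theorems.KLProgrammeKLRegimeEngineV8RaiseDoors
import Summits.HubbardSuperconductivity.HubbardSuperconductivity.Theorems.KLProgrammeKLRegimeEngineV8E5Share2
import Summits.HubbardSuperconductivity.HubbardSuperconductivity.Theorems.KLProgrammeKLRegimeEngineV8TowerGeneric

/-!
# K3 ENGINE package, `Q`-level v9c: `klEngQ9c P R := ((klEngQ8 P R).withCR (max (klEngQ8 P R).CR (klE5Raise2 P R))).withCE e_T` with the ATOM-FREE
# tree-expansion constant `e_T := klEngQ9cCE P R := max (klEngQ8 P R).CE (klTowerCoreCE P R)` (token #13 successor — plan g20 (R66a), 2026-08-27)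

Cell `gate-hubbard-kl`.  Owner of record of the `Q`-Defs chain (…DefsQ2/…/DefsQ9) and of token #13: the k3c2-p1 lineage; this successor was PRE-STAGED by the
E1 lead (hubbard-kl-r2d-p2 g8) the hour `…EngineV8TowerGeneric` (p572419) landed, per (R66a) («E1 lineage = fallback filer»).  It is `…DefsQ9` (p563030)
VERBATIM with ONE substitution: the tower's public constant `klTowerCE P R` (first component of the `Classical.choose` package over TODAY's conj.-4 literal
text of `TowerNormsStep`) is replaced by **`klTowerCoreCE P R`** (…TowerGeneric §2: the constant of the ATOM-FREE core package `klTowerCorePkg P R` over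
`TowerCoreStep := TowerLevelsStep ∧ TowerFirstMomentsStep`), so that token #13 no longer reads the grid atom and the 08-28 currency decision on conj. 4
((T′-B) / (c)+(W)) cannot drag it again: under EITHER branch the (b) v2 closer reads the generic closer `towerNormsStepG_klTowerG_of_exists` at
`Q := klEngQ9c P R` with `isRaiseOf_klEngQ9c_klEngQ8` and `klTowerCoreCE_le_klEngQ9c_CE` (its `Q₀.IsRaiseOf Q` / `CE ≤ Q.CE`), and the DefsU11 row is
`⊓ klTowerUG P R (klTowerGrid P R) (klEngQ9c P R) cc`.

Contents = …DefsQ9's, renamed `9 ↦ 9c`: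
* §1 **`klEngQ9cCE`**, **`klEngQ9c P R`**, `klEngQ9c_eq`, `klEngQ9c_CR`, `klEngQ9c_CE_eq`, the order rows `klEngQ8_CR_le_klEngQ9c_CR`, `klEngQ7_CR_le_klEngQ9c_CR`,
  **`klE5Raise2_le_klEngQ9c_CR`**, `klE5Raise_le_klEngQ9c_CR`, `klEngQ8_CE_le_klEngQ9c_CE`, `klEngQ7_CE_le_klEngQ9c_CE`, **`klTowerCoreCE_le_klEngQ9c_CE`**; the raise rows
  **`isRaiseOf_klEngQ9c_klEngQ8`**, **`isRaiseOf_klEngQ9c`**, `isRaiseOf_klEngQ9c_family`, `klEngQ9c_wf`, the pinned rows `S'`, `c0`, `cE4`, `Bf`, `SL`, `CL`, `L0`, `M0`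
  (`rfl` against `klEngQ7`), `klEngQ9c_CL_apply`, `klEngQ9c_eq_raise`, `deltaUV_absorbed9c`, the `CE`-threshold riders;
* §2 the instantiated doors `klEngQ8 ⟶ klEngQ9c` (raise-invariant readers `…_klEngQ9c_iff`; the `CE`-monotone lifts `…_klEngQ9c_of_klEngQ8`).

Registrant token #13: `klEngQ7 ↦ klEngQ9c` (+ `klEngQ7_wf ↦ klEngQ9c_wf`, this import) once this file is ACCEPTED (pen (R66a): pre-FREEZE, ONE re-point, BOTH
branches).  Definitions with bodies + order lemmas only; nothing about the model is asserted; nothing asserts superconductivity.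
-/

noncomputable section

namespace Summit.HubbardSuperconductivity.HubbardSuperconductivity.Theorems.EngineV8

set_option linter.dupNamespace false -- summit = problem name (single-conjunct summit), D-0017

open Real Finset Literature.MathematicalPhysics.QuantumLattice Literature.Probability.LatticeModels
open Summit.HubbardSuperconductivity.HubbardSuperconductivity.Theorems.KLRegimeSplit
open Summit.HubbardSuperconductivity.HubbardSuperconductivity.Theorems.KLProgrammeLegKernels

/-! ## §1 The package `klEngQ9c` -/

/-- **`klEngQ9cCE P R` — the tree-expansion constant `e_T` of token #13** (TABLE B′, atom-free successor: `max (klEngQ8 P R).CE (klTowerCoreCE P R)`). -/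
def klEngQ9cCE (P : SplitConsts) (R : RenConsts) : ℝ := max (klEngQ8 P R).CE (klTowerCoreCE P R)

/-- `(klEngQ8 P R).CE ≤ klEngQ9cCE P R` (the only property of `e_T` the rows below read). -/
theorem klEngQ8_CE_le_klEngQ9cCE (P : SplitConsts) (R : RenConsts) : (klEngQ8 P R).CE ≤ klEngQ9cCE P R := le_max_left _ _

/-- `klTowerCoreCE P R ≤ klEngQ9cCE P R` — the tower's table fits under token #13's `CE` (the CE-fit row `klCU2 … p ≤ (klEngQ9c P R).CE^p` starts here). -/
theorem klTowerCoreCE_le_klEngQ9cCE (P : SplitConsts) (R : RenConsts) : klTowerCoreCE P R ≤ klEngQ9cCE P R := le_max_right _ _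

/-- **`klEngQ9c P R` — the engine-flow package's `Q`, v9c (token #13 under every table, atom-free `e_T`)**: `klEngQ8 P R` with `CR := max (klEngQ8 P R).CR (klE5Raise2 P R)`
(the successor E.5 share of class #3) and `CE := klEngQ9cCE P R` (`e_T`), NOTHING else moved. -/
def klEngQ9c (P : SplitConsts) (R : RenConsts) : EngConsts :=
  ((klEngQ8 P R).withCR (max (klEngQ8 P R).CR (klE5Raise2 P R))).withCE (klEngQ9cCE P R)

section Rows

variable (P : SplitConsts) (R : RenConsts)

/-- `klEngQ9c P R = ((klEngQ8 P R).withCR (max (klEngQ8 P R).CR (klE5Raise2 P R))).withCE (klEngQ9cCE P R)` (`rfl`). -/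
theorem klEngQ9c_eq : klEngQ9c P R = ((klEngQ8 P R).withCR (max (klEngQ8 P R).CR (klE5Raise2 P R))).withCE (klEngQ9cCE P R) := rfl

/-- `(klEngQ9c P R).CR = max (klEngQ8 P R).CR (klE5Raise2 P R)`. -/
theorem klEngQ9c_CR : (klEngQ9c P R).CR = max (klEngQ8 P R).CR (klE5Raise2 P R) := rfl

/-- `(klEngQ9c P R).CE = klEngQ9cCE P R`. -/
theorem klEngQ9c_CE_eq : (klEngQ9c P R).CE = klEngQ9cCE P R := rfl

/-- **`(klEngQ8 P R).CR ≤ (klEngQ9c P R).CR`** (`klEngQ9c_CR_ge` of the sheet) — the lift input of every conclusion-side `CR`-reader. -/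
theorem klEngQ8_CR_le_klEngQ9c_CR : (klEngQ8 P R).CR ≤ (klEngQ9c P R).CR := le_max_left _ _

/-- `(klEngQ7 P R).CR ≤ (klEngQ9c P R).CR`. -/
theorem klEngQ7_CR_le_klEngQ9c_CR : (klEngQ7 P R).CR ≤ (klEngQ9c P R).CR := (klEngQ7_CR_le_klEngQ8_CR P R).trans (klEngQ8_CR_le_klEngQ9c_CR P R)

/-- **`klE5Raise2 P R ≤ (klEngQ9c P R).CR`** — the successor E.5 share sits inside the v9 cubic budget (the `hCC` of `E5ShareStep2.mono` / the (c) closer). -/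
theorem klE5Raise2_le_klEngQ9c_CR : klE5Raise2 P R ≤ (klEngQ9c P R).CR := le_max_right _ _

/-- `klE5Raise P R ≤ (klEngQ9c P R).CR` (the rev-1 share rides). -/
theorem klE5Raise_le_klEngQ9c_CR : klE5Raise P R ≤ (klEngQ9c P R).CR := (klE5Raise_le_klEngQ8_CR P R).trans (klEngQ8_CR_le_klEngQ9c_CR P R)

/-- **`(klEngQ8 P R).CE ≤ (klEngQ9c P R).CE`** (every table). -/
theorem klEngQ8_CE_le_klEngQ9c_CE : (klEngQ8 P R).CE ≤ (klEngQ9c P R).CE := klEngQ8_CE_le_klEngQ9cCE P R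

/-- `(klEngQ7 P R).CE ≤ (klEngQ9c P R).CE`. -/
theorem klEngQ7_CE_le_klEngQ9c_CE : (klEngQ7 P R).CE ≤ (klEngQ9c P R).CE := (klEngQ8_CE P R).ge.trans (klEngQ8_CE_le_klEngQ9c_CE P R)

/-- `klTowerCoreCE P R ≤ (klEngQ9c P R).CE`. -/
theorem klTowerCoreCE_le_klEngQ9c_CE : klTowerCoreCE P R ≤ (klEngQ9c P R).CE := klTowerCoreCE_le_klEngQ9cCE P R

/-- **`klEngQ9c P R` is a raise of `klEngQ8 P R`** (`CR` by the E.5 share, `CE` to `e_T`). -/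
theorem isRaiseOf_klEngQ9c_klEngQ8 : (klEngQ8 P R).IsRaiseOf (klEngQ9c P R) :=
  EngConsts.isRaiseOf_withCR_withCE (le_max_left _ _) (klEngQ8_CE_le_klEngQ9cCE P R)

/-- **TOKEN #13 IS A RAISE OF THE TABLE KEY: `(klEngQ7 P R).IsRaiseOf (klEngQ9c P R)`** — the `hQ` of every successor class Step at `Q := klEngQ9c P R`
(K2 composition) and the `hQT` of `stub_engine_scale0_klEng8_raise klEngQ9c` (the v2-(a) re-closer). -/
theorem isRaiseOf_klEngQ9c : (klEngQ7 P R).IsRaiseOf (klEngQ9c P R) := (isRaiseOf_klEngQ8 P R).trans (isRaiseOf_klEngQ9c_klEngQ8 P R)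

/-- The family form the re-closers take: `∀ P R, (klEngQ7 P R).IsRaiseOf (klEngQ9c P R)`. -/
theorem isRaiseOf_klEngQ9c_family : ∀ (P : SplitConsts) (R : RenConsts), (klEngQ7 P R).IsRaiseOf (klEngQ9c P R) := isRaiseOf_klEngQ9c

/-- **`klEngQ9c P R` is well formed** (token line `klEngQ7_wf ↦ klEngQ9c_wf`). -/
theorem klEngQ9c_wf : (klEngQ9c P R).WF := (isRaiseOf_klEngQ9c P R).wf (klEngQ7_wf P R)

/-- `0 ≤ (klEngQ9c P R).CE`. -/
theorem klEngQ9c_CE_nonneg : 0 ≤ (klEngQ9c P R).CE := (klEngQ9c_wf P R).1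

/-- `0 ≤ (klEngQ9c P R).CR`. -/
theorem klEngQ9c_CR_nonneg : 0 ≤ (klEngQ9c P R).CR := (klEngQ9c_wf P R).2.1

/-- `klWtCE R ≤ (klEngQ9c P R).CE` (the scale-`0` weighted-level threshold rides). -/
theorem klWtCE_le_klEngQ9c_CE : klWtCE R ≤ (klEngQ9c P R).CE := (klWtCE_le_klEngQ8_CE P R).trans (klEngQ8_CE_le_klEngQ9c_CE P R)

/-- `klE1CE P ≤ (klEngQ9c P R).CE` (the (E1-v4)₀ threshold rides). -/
theorem klE1CE_le_klEngQ9c_CE : klE1CE P ≤ (klEngQ9c P R).CE := (klE1CE_le_klEngQ8_CE P R).trans (klEngQ8_CE_le_klEngQ9c_CE P R)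

/-- `klCE6 P R ≤ (klEngQ9c P R).CE` (the v6 table rides). -/
theorem klCE6_le_klEngQ9c_CE : klCE6 P R ≤ (klEngQ9c P R).CE := (klCE6_le_klEngQ8_CE P R).trans (klEngQ8_CE_le_klEngQ9c_CE P R)

/-- `(klEngQ6 P R).CE ≤ (klEngQ9c P R).CE`. -/
theorem klEngQ6_CE_le_klEngQ9c_CE : (klEngQ6 P R).CE ≤ (klEngQ9c P R).CE := (klEngQ6_CE_le_klEngQ8_CE P R).trans (klEngQ8_CE_le_klEngQ9c_CE P R)

/-- pinned row `S'` (`rfl` against `klEngQ7`). -/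
theorem klEngQ9c_S' : (klEngQ9c P R).S' = (klEngQ7 P R).S' := rfl
/-- pinned row `c0`. -/
theorem klEngQ9c_c0 : (klEngQ9c P R).c0 = (klEngQ7 P R).c0 := rfl
/-- pinned row `cE4`. -/
theorem klEngQ9c_cE4 : (klEngQ9c P R).cE4 = (klEngQ7 P R).cE4 := rfl
/-- pinned row `Bf`. -/
theorem klEngQ9c_Bf : (klEngQ9c P R).Bf = (klEngQ7 P R).Bf := rfl
/-- pinned row `SL`. -/
theorem klEngQ9c_SL : (klEngQ9c P R).SL = (klEngQ7 P R).SL := rfl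
/-- pinned row `CL`. -/
theorem klEngQ9c_CL : (klEngQ9c P R).CL = (klEngQ7 P R).CL := rfl
/-- pinned row `L0`. -/
theorem klEngQ9c_L0 : (klEngQ9c P R).L0 = (klEngQ7 P R).L0 := rfl
/-- pinned row `M0`. -/
theorem klEngQ9c_M0 : (klEngQ9c P R).M0 = (klEngQ7 P R).M0 := rfl

/-- `(klEngQ9c P R).CL β n = (klEngQ7 P R).CL β n` (the (c)-E5 volume line `sum_CL_klEngQ7_div_le` rides token #13 verbatim). -/
theorem klEngQ9c_CL_apply (β : ℝ) (n : ℕ) : (klEngQ9c P R).CL β n = (klEngQ7 P R).CL β n := rfl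

/-- **The v9 package as a raise of the table key in closed form**: `klEngQ9c P R = ((klEngQ7 P R).withCR (klEngQ9c P R).CR).withCE (klEngQ9c P R).CE`
(`IsRaiseOf.eq`; the instantiation line of a `CR`/`CE`-generic closer written at `(Q₀.withCR r).withCE e`). -/
theorem klEngQ9c_eq_raise : klEngQ9c P R = ((klEngQ7 P R).withCR (klEngQ9c P R).CR).withCE (klEngQ9c P R).CE := (isRaiseOf_klEngQ9c P R).eq

/-- `deltaUV` absorption rides to v9 (`CR` only grows). -/
theorem deltaUV_absorbed9c : 32 * R.Gfr 0 + 4 * R.cr ≤ (klEngQ9c P R).CR := (deltaUV_absorbed8 P R).trans (klEngQ8_CR_le_klEngQ9c_CR P R)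

end Rows

/-! ## §2 The instantiated doors `klEngQ8 ⟶ klEngQ9c` (via …EngineV8RaiseDoors at `isRaiseOf_klEngQ9c_klEngQ8`) -/

section Model

variable {L M : ℕ} [NeZero L] [NeZero M] {G : GeoConsts} {P : SplitConsts} {R : RenConsts} {β U μ : ℝ} {K : TrigPolyC4v} {n : ℕ}

/-- (E3a-F) at `klEngQ9c` IS (E3a-F) at `klEngQ8` (`S'` pinned). -/
theorem twoLegReadJetsF_klEngQ9c_iff : TwoLegReadJetsF L M G (klEngQ9c P R) β U μ n ↔ TwoLegReadJetsF L M G (klEngQ8 P R) β U μ n :=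
  twoLegReadJetsF_isRaiseOf_iff (isRaiseOf_klEngQ9c_klEngQ8 P R)

/-- (E4) at `klEngQ9c` IS (E4) at `klEngQ8` (`cE4` pinned). -/
theorem engineFirstMoments_klEngQ9c_iff :
    EngineFirstMoments L M G P (klEngQ9c P R) β U μ K n ↔ EngineFirstMoments L M G P (klEngQ8 P R) β U μ K n :=
  engineFirstMoments_isRaiseOf_iff (isRaiseOf_klEngQ9c_klEngQ8 P R)

/-- (E3f-F) at `n = 0`: `klEngQ9c` IS `klEngQ8`, for any two histories (`M0`, `CL` pinned). -/
theorem twoLegVolumeRateF_zero_klEngQ9c_iff (hist hist' : (L' M' : ℕ) → [NeZero L'] → [NeZero M'] → ℕ → Prop) :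
    TwoLegVolumeRateF L M hist (klEngQ9c P R) β U μ 0 ↔ TwoLegVolumeRateF L M hist' (klEngQ8 P R) β U μ 0 :=
  twoLegVolumeRateF_zero_isRaiseOf_iff (isRaiseOf_klEngQ9c_klEngQ8 P R) hist hist'

omit [NeZero M] in
/-- **(E1-v4) lifts `klEngQ8 → klEngQ9c`** (`P.WF`; `CE` monotone). -/
theorem kernelNormsV4_klEngQ9c_of_klEngQ8 (hP : P.WF) (h : KernelNormsV4 L M P (klEngQ8 P R) β U μ K n) :
    KernelNormsV4 L M P (klEngQ9c P R) β U μ K n :=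
  kernelNormsV4_of_isRaiseOf (isRaiseOf_klEngQ9c_klEngQ8 P R) (klEngQ8_wf P R).1 (zero_le_one.trans hP.1) h

omit [NeZero M] in
/-- **The levelled norms lift `klEngQ8 → klEngQ9c`** (`P.WF`). -/
theorem kernelNormsLevels_klEngQ9c_of_klEngQ8 (hP : P.WF) (h : KernelNormsLevels L M P (klEngQ8 P R) β U μ K n) :
    KernelNormsLevels L M P (klEngQ9c P R) β U μ K n :=
  kernelNormsLevels_of_isRaiseOf (isRaiseOf_klEngQ9c_klEngQ8 P R) (klEngQ8_wf P R).1 (zero_le_one.trans hP.1) h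

omit [NeZero M] in
/-- **The weighted levels at the budget lift `klEngQ8 → klEngQ9c`** (`P.WF`). -/
theorem kernelNormsWt4_klWtBudget_klEngQ9c_of_klEngQ8 (hP : P.WF) {j : ℕ} (h : KernelNormsWt4 L M (klWtBudget P (klEngQ8 P R) U j) β U μ K j) :
    KernelNormsWt4 L M (klWtBudget P (klEngQ9c P R) U j) β U μ K j :=
  kernelNormsWt4_klWtBudget_of_isRaiseOf (isRaiseOf_klEngQ9c_klEngQ8 P R) (klEngQ8_wf P R).1 (zero_le_one.trans hP.1) h

/-- **(E2-F2)ₙ lifts `klEngQ8 → klEngQ9c`** (`P.WF`). -/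
theorem pairLadderStepAtV17F2_klEngQ9c_of_klEngQ8 (hP : P.WF) (h : PairLadderStepAtV17F2 L M G P (klEngQ8 P R) β U μ n) :
    PairLadderStepAtV17F2 L M G P (klEngQ9c P R) β U μ n :=
  pairLadderStepAtV17F2_of_isRaiseOf (isRaiseOf_klEngQ9c_klEngQ8 P R) (zero_le_one.trans hP.1) h

/-- **(E2″-F)ₙ lifts `klEngQ8 → klEngQ9c`** (`P.WF`). -/
theorem pairValueIncrementAtV17F_klEngQ9c_of_klEngQ8 (hP : P.WF) (h : PairValueIncrementAtV17F L M G P (klEngQ8 P R) β U μ n) :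
    PairValueIncrementAtV17F L M G P (klEngQ9c P R) β U μ n :=
  pairValueIncrementAtV17F_of_isRaiseOf (isRaiseOf_klEngQ9c_klEngQ8 P R) (zero_le_one.trans hP.1) h

/-- **(E2′-F)ₙ lifts `klEngQ8 → klEngQ9c`** (`P.WF`). -/
theorem quarticValueIncrementAtV17F_klEngQ9c_of_klEngQ8 (hP : P.WF) (h : QuarticValueIncrementAtV17F L M G P (klEngQ8 P R) β U μ n) :
    QuarticValueIncrementAtV17F L M G P (klEngQ9c P R) β U μ n :=
  quarticValueIncrementAtV17F_of_isRaiseOf (isRaiseOf_klEngQ9c_klEngQ8 P R) (zero_le_one.trans hP.1) h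

/-- **(E2′-F UV) lifts `klEngQ8 → klEngQ9c`** (`P.WF`). -/
theorem quarticValueUVAtV17F_klEngQ9c_of_klEngQ8 (hP : P.WF) (h : QuarticValueUVAtV17F L M G P (klEngQ8 P R) β U μ n) :
    QuarticValueUVAtV17F L M G P (klEngQ9c P R) β U μ n :=
  quarticValueUVAtV17F_of_isRaiseOf (isRaiseOf_klEngQ9c_klEngQ8 P R) (zero_le_one.trans hP.1) h

/-- **The split slot lifts `klEngQ8 → klEngQ9c`** (`P.WF`). -/
theorem betaSplitAtV17F_klEngQ9c_of_klEngQ8 (hP : P.WF) (h : BetaSplitAtV17F L M G P (klEngQ8 P R) β U μ n) :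
    BetaSplitAtV17F L M G P (klEngQ9c P R) β U μ n :=
  betaSplitAtV17F_of_isRaiseOf (isRaiseOf_klEngQ9c_klEngQ8 P R) (zero_le_one.trans hP.1) h

/-- **The cured engine slot lifts `klEngQ8 → klEngQ9c`** (`P.WF`; every scale `n`). -/
theorem engineBoundsAtV17F2_klEngQ9c_of_klEngQ8 (hP : P.WF) (h : EngineBoundsAtV17F2 L M G P (klEngQ8 P R) β U μ n) :
    EngineBoundsAtV17F2 L M G P (klEngQ9c P R) β U μ n :=
  engineBoundsAtV17F2_of_isRaiseOf (isRaiseOf_klEngQ9c_klEngQ8 P R) (klEngQ8_wf P R).1 (zero_le_one.trans hP.1) h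

/-- **The comparison-volume history conjunct lifts `klEngQ8 → klEngQ9c`** (`P.WF`). -/
theorem histV17F2_klEngQ9c_of_klEngQ8 (hP : P.WF) {j : ℕ} (h : histV17F2 L M G P (klEngQ8 P R) R β U μ j) :
    histV17F2 L M G P (klEngQ9c P R) R β U μ j :=
  histV17F2_of_isRaiseOf (isRaiseOf_klEngQ9c_klEngQ8 P R) (klEngQ8_wf P R).1 (zero_le_one.trans hP.1) h

end Model

end Summit.HubbardSuperconductivity.HubbardSuperconductivity.Theorems.EngineV8

end
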